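import Literature.NumberTheory.LFunctions.ZeroDensityGuthMaynard
import Literature.NumberTheory.LFunctions.LargeValuesS3Bound
import HarnessLib

/-!
# The `30/13` zero-density theorem holds (discharge of `zeroDensity_thirty_thirteenths`)

Topic `NumberTheory/LFunctions`, family RH, statement **rh.S12**. The named fact
`Literature.NumberTheory.LFunctions.zeroDensity_thirty_thirteenths` (`ZeroCounting.lean`):
`N(σ, T) ≪_ε T^{(30/13)(1−σ)+ε}` for `1/2 ≤ σ ≤ 1` — the display following Theorem 1.2 of
L. Guth, J. Maynard, *New large value estimates for Dirichlet polynomials*, Ann. of Math. (2) 203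
(2026) = arXiv:2405.20552: "Combining this with Ingham's estimate when `σ ≤ 7/10`, we obtain
`N(σ,T) ≤ T^{30(1−σ)/13+o(1)}`".

Everything needed is already PROVED in the tree:

* `zeroDensity_thirty_thirteenths_of_guth_maynard` (`ZeroDensityGuthMaynard.lean`) — the printed
  assembly `zeroDensity_guth_maynard → zeroDensity_thirty_thirteenths`, Ingham's theorem on
  `[1/2, 7/10]` being the tree's `zeroDensity_ingham_holds`;
* `zeroDensity_guth_maynard_holds` (`LargeValuesS3Bound.lean`) — Guth–Maynard's Theorem 1.2 on
  `[7/10, 1]`, the end point of the programme `LargeValuesGuthMaynardReduction` (§3),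
  `LargeValuesTraceMethod` / `LargeValuesFourierDecay` / `LargeValuesTraceExpansion` (§§4–5),
  `LargeValuesS2AFE` / `LargeValuesS2Bound` (§6, with Heath-Brown's theorem
  `DoubleZetaSumsHeathBrown`), `LargeValuesRFunction` … `LargeValuesS3Bound` (§§7–10),
  `LargeValuesEnergyBound` (§11), `LargeValuesAssembly` (§12), `ZeroDensityGuthMaynardWindow` (§13).

This file only composes the two. No definition and no named fact is introduced.

## References

* L. Guth, J. Maynard, *New large value estimates for Dirichlet polynomials*, Ann. of Math. (2) 203
  (2026), no. 2, 623–675; arXiv:2405.20552. Thm. 1.1, Thm. 1.2 and the display following it.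
  [key `GuthMaynard2026`; the decl's tag `GuthMaynard2024` is an interim stub of the same paper]
* A. E. Ingham, *On the estimation of `N(σ, T)`*, Quart. J. Math. Oxford 11 (1940) 291–292.
-/

noncomputable section

namespace Literature.NumberTheory.LFunctions

/-- **The `30/13` density theorem holds**: `N(σ, T) ≪_ε T^{(30/13)(1−σ)+ε}` for every
`1/2 ≤ σ ≤ 1` — Guth–Maynard's Theorem 1.2 (`zeroDensity_guth_maynard_holds`) combined with
Ingham's estimate below `σ = 7/10` (`zeroDensity_thirty_thirteenths_of_guth_maynard`).
[cite: GuthMaynard2026, Thm. 1.2 and the display following it] -/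
theorem zeroDensity_thirty_thirteenths_holds : zeroDensity_thirty_thirteenths :=
  zeroDensity_thirty_thirteenths_of_guth_maynard zeroDensity_guth_maynard_holds

end Literature.NumberTheory.LFunctions

end
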